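import Summits.AtomisticToContinuum.Crystallization.Theorems.ExcessDecayLiouvilleHcpLiouvilleBlowdownTheta
import Summits.AtomisticToContinuum.Crystallization.Theorems.ExcessDecayLiouvilleHcpLiouvilleBlowdownReadout
import Summits.AtomisticToContinuum.Crystallization.Theorems.ExcessDecayLiouvilleHcpLiouvilleBlowdownIteration

/-!
# `ExcessDecayLiouville.HcpLiouville` (stmt-AtomisticToContinuum-9332), line `Sketch` (skeleton v4): stub `stub_interior`

The interior oscillation decay for `L`-harmonic fields (interface `Blowdown.InteriorDecayProp`, step (D) of the
blow-down of crux stmt-AtomisticToContinuum-9332, line `Sketch` v4): for the sites `S` of an admissible hcp-like datum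
with `PSIneq κ`, a field `z` that is `L`-harmonic on `B_R(c)` (full, infinite-range rows) with far part
`z − m = a + b`, `|a| ≤ Y₀`, `Σ|b|² ≤ Y₂²`, and `1 ≤ r ≤ R/16`, some constant `m′` has
`oscAt S z c r m′ ≤ C(κ)·((r/R)⁴·oscAt S z c R m + r⁵(Y₀²R⁻⁶ + Y₂²R⁻⁸))`.  Large scales (`R ≥ 400`, `7r + 24 ≤ R/25`):
localisation `ẑ = 𝟙_{B_{4R/5}}(z − m)` (…Localise), far-field forcing through kernel differences (…KernelDiff, …Forcing),
four linear Caccioppoli levels (…Levels, …LevelsLow/High), lattice Sobolev for the generator and cross differences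
(…SobolevGen/Cross, …Theta) and the read-out along lattice paths (…Readout): `blowdown_interiorMain`.  The remaining
scales are trivial by monotonicity of `oscAt` in the radius (`r/R ≥ 1/775`).  Registered: `stub_interior`.
All `[folklore]`; a `--supports` helper for item stmt-AtomisticToContinuum-9332, nothing here closes an item.
-/

noncomputable section

namespace Summit.AtomisticToContinuum.Crystallization.Theorems.ExcessDecayLiouville

open scoped BigOperators Topology Classical InnerProductSpace RealInnerProductSpace
open Literature.MathematicalPhysics.StatisticalMechanics
open Summit.AtomisticToContinuum.Crystallization.Theses.ExcessDecayLiouville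
open Summit.AtomisticToContinuum.Crystallization.Theorems.PhononStabilityNegative
open LevelOne

/-- **The main case of the interior estimate** (`R ≥ 400`, `7r + 24 ≤ R/25`): pointwise difference bounds
(`blowdown_theta`) and the read-out (`blowdown_readout`) for the localised field, which agrees with `z − m` on `B_r(c)`.
[folklore] -/
theorem blowdown_interiorMain : ∃ C : ℝ, 0 ≤ C ∧ ∀ (C_L κ K : ℝ) (t : Fin 2 → (EuclideanSpace ℝ (Fin 3))) (A : (EuclideanSpace ℝ (Fin 3)) →L[ℝ] (EuclideanSpace ℝ (Fin 3))),
    (∀ (κ : ℝ) (t : Fin 2 → (EuclideanSpace ℝ (Fin 3))) (A : (EuclideanSpace ℝ (Fin 3)) →L[ℝ] (EuclideanSpace ℝ (Fin 3))), 0 < κ → Adm₀ A → Inner₀ t A → Blowdown.PSIneq κ t A →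
      ∀ (F g : (EuclideanSpace ℝ (Fin 3)) → (EuclideanSpace ℝ (Fin 3))) (c : (EuclideanSpace ℝ (Fin 3))) (ρ₁ δ ρK R₀ Γ μ : ℝ), 4 ≤ ρ₁ → 1 ≤ δ → δ ≤ ρ₁ → ρ₁ + 2 * δ ≤ ρK → ρK ≤ R₀ →
        0 ≤ Γ → 0 < μ → (∀ q : Sites₀ t A, R₀ < dist (q : (EuclideanSpace ℝ (Fin 3))) c → F q = 0) →
        (∀ p : Sites₀ t A, dist (p : (EuclideanSpace ℝ (Fin 3))) c ≤ ρ₁ + δ →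
          HasSum (fun q : Sites₀ t A => forceConst ((p : (EuclideanSpace ℝ (Fin 3))) - q) (F p - F q)) (g p)) →
        (∀ p : Sites₀ t A, dist (p : (EuclideanSpace ℝ (Fin 3))) c ≤ ρ₁ + δ → ‖g p‖ ^ 2 ≤ Γ) →
        Blowdown.nnEnergy (Sites₀ t A) F c (ρ₁ - 2) ≤
          C_L / κ * ((δ⁻¹) ^ 2 * Blowdown.oscAt (Sites₀ t A) F c ρK 0 + δ ^ 2 * ρK ^ 3 * Γ +
            (δ⁻¹) ^ 8 * (μ * R₀ ^ 3 * Blowdown.oscAt (Sites₀ t A) F c R₀ 0 +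
              μ⁻¹ * ρK ^ 3 * Blowdown.oscAt (Sites₀ t A) F c ρK 0))) →
    0 < κ → Adm₀ A → Inner₀ t A → Blowdown.PSIneq κ t A →
    ∀ (z b : (EuclideanSpace ℝ (Fin 3)) → (EuclideanSpace ℝ (Fin 3))) (c m : (EuclideanSpace ℝ (Fin 3))) (R Y₀ Y₂ r : ℝ), 400 ≤ R → 0 ≤ Y₀ → 0 ≤ Y₂ →
      (∀ p ∈ Sites₀ t A, ‖z p - m - b p‖ ≤ Y₀) →
      Summable (fun p : Sites₀ t A => ‖b p‖ ^ 2) → (∑' p : Sites₀ t A, ‖b p‖ ^ 2) ≤ Y₂ ^ 2 →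
      Blowdown.IsHarmonicOn (Sites₀ t A) z c R → 1 ≤ K → C_L / κ ≤ K → 1 ≤ r → 7 * r + 24 ≤ R / 25 →
      ∃ m' : (EuclideanSpace ℝ (Fin 3)), Blowdown.oscAt (Sites₀ t A) z c r m' ≤
        C * K ^ 4 * ((r / R) ^ 4 * Blowdown.oscAt (Sites₀ t A) z c R m + r ^ 5 * (Y₀ ^ 2 * (R⁻¹) ^ 6 + Y₂ ^ 2 * (R⁻¹) ^ 8)) := by
  obtain ⟨C_T, hCT0, hT⟩ := blowdown_theta
  obtain ⟨C_P, hCP0, hP⟩ := blowdown_readout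
  refine ⟨C_P * C_T, by positivity, ?_⟩
  intro C_L κ K t A hL hκ hA hI hPS z b c m R Y₀ Y₂ r hR hY₀ hY₂ ha hb hb2 hz hK1 hKC hr h7r
  obtain ⟨zh, hzh⟩ : ∃ zh : (EuclideanSpace ℝ (Fin 3)) → (EuclideanSpace ℝ (Fin 3)), ∀ x, zh x = if dist x c ≤ 4 * R / 5 then z x - m else 0 :=
    ⟨fun x => if dist x c ≤ 4 * R / 5 then z x - m else 0, fun _ => rfl⟩
  obtain ⟨hgenb, hcrossb⟩ := hT C_L κ K t A hL hκ hA hI hPS z b zh c m R Y₀ Y₂ hR hY₀ hY₂ ha hb hb2 hz hzh hK1 hKC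
  have hR0 : 0 < R := by linarith
  have hK0 : 0 ≤ K := by linarith
  have hu0 : 0 ≤ R⁻¹ := by positivity
  have hosc0 : 0 ≤ Blowdown.oscAt (Sites₀ t A) z c R m := Blowdown.oscAt_nonneg _ _ _ _ _
  have hW0 : 0 ≤ (Blowdown.oscAt (Sites₀ t A) z c R m + Y₀ ^ 2 * R⁻¹ + Y₂ ^ 2 * (R⁻¹) ^ 3) := by positivity
  have hΘ0 : 0 ≤ C_T * K ^ 4 * (R⁻¹) ^ 5 * (Blowdown.oscAt (Sites₀ t A) z c R m + Y₀ ^ 2 * R⁻¹ + Y₂ ^ 2 * (R⁻¹) ^ 3) := by positivity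
  obtain ⟨m', hm'⟩ := hP t A hA hI zh c (R / 25) (C_T * K ^ 4 * (R⁻¹) ^ 5 * (Blowdown.oscAt (Sites₀ t A) z c R m + Y₀ ^ 2 * R⁻¹ + Y₂ ^ 2 * (R⁻¹) ^ 3)) r hΘ0 hr h7r hgenb hcrossb
  refine ⟨m' + m, ?_⟩
  have heq : Blowdown.oscAt (Sites₀ t A) z c r (m' + m) = Blowdown.oscAt (Sites₀ t A) zh c r m' := by
    unfold Blowdown.oscAt
    refine tsum_congr fun p => ?_
    have hp : dist (p : (EuclideanSpace ℝ (Fin 3))) c ≤ 4 * R / 5 := p.2.2.trans (by linarith)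
    rw [hzh, if_pos hp]
    congr 1
    abel
  rw [heq]
  refine hm'.trans ?_
  have hrR : r / R ≤ 1 := by rw [div_le_one hR0]; linarith
  have hrR0 : 0 ≤ r / R := by positivity
  have h54 : (r / R) ^ 5 ≤ (r / R) ^ 4 := pow_le_pow_of_le_one hrR0 hrR (by norm_num)
  have hid : C_P * r ^ 5 * (C_T * K ^ 4 * (R⁻¹) ^ 5 * (Blowdown.oscAt (Sites₀ t A) z c R m + Y₀ ^ 2 * R⁻¹ + Y₂ ^ 2 * (R⁻¹) ^ 3)) =
      C_P * C_T * K ^ 4 * ((r / R) ^ 5 * Blowdown.oscAt (Sites₀ t A) z c R m +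
        r ^ 5 * (Y₀ ^ 2 * (R⁻¹) ^ 6 + Y₂ ^ 2 * (R⁻¹) ^ 8)) := by
    rw [div_eq_mul_inv, mul_pow]; ring
  rw [hid]
  have hr5 : 0 ≤ r ^ 5 * (Y₀ ^ 2 * (R⁻¹) ^ 6 + Y₂ ^ 2 * (R⁻¹) ^ 8) := by positivity
  have hmono : (r / R) ^ 5 * Blowdown.oscAt (Sites₀ t A) z c R m ≤ (r / R) ^ 4 * Blowdown.oscAt (Sites₀ t A) z c R m :=
    mul_le_mul_of_nonneg_right h54 hosc0
  exact mul_le_mul_of_nonneg_left (by linarith) (by positivity)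

/-- **Stub `stub_interior`** of the skeleton (crux stmt-AtomisticToContinuum-9332, line `Sketch` v4): interior
oscillation decay for `L`-harmonic fields in the working form `Blowdown.InteriorDecayProp`. [folklore] -/
theorem stub_interior : ∀ κ : ℝ, 0 < κ → ∃ C : ℝ, Blowdown.InteriorDecayProp κ C := by
  intro κ hκ
  obtain ⟨C_L, hCL0, hL⟩ := blowdown_levelStep
  obtain ⟨C_M, hCM0, hM⟩ := blowdown_interiorMain
  refine ⟨C_M * ((C_L + 1) * (κ⁻¹ + 1)) ^ 4 + 775 ^ 4, ?_⟩
  intro t A hA hI hPS z b c m R Y₀ Y₂ hR hY₀ hY₂ ha hb hb2 hz r hr hrR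
  have hκi : 0 < κ⁻¹ := inv_pos.2 hκ
  have hK1 : 1 ≤ (C_L + 1) * (κ⁻¹ + 1) := by nlinarith
  have hKC : C_L / κ ≤ (C_L + 1) * (κ⁻¹ + 1) := by rw [div_eq_mul_inv]; nlinarith
  have hR0 : 0 < R := by linarith
  have hu0 : 0 ≤ R⁻¹ := by positivity
  have hosc0 : 0 ≤ Blowdown.oscAt (Sites₀ t A) z c R m := Blowdown.oscAt_nonneg _ _ _ _ _
  have hrR0 : 0 ≤ r / R := by positivity
  have hX0 : 0 ≤ (r / R) ^ 4 * Blowdown.oscAt (Sites₀ t A) z c R m + r ^ 5 * (Y₀ ^ 2 * (R⁻¹) ^ 6 + Y₂ ^ 2 * (R⁻¹) ^ 8) := by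
    positivity
  have hK4 : 0 ≤ C_M * ((C_L + 1) * (κ⁻¹ + 1)) ^ 4 := by positivity
  by_cases hcase : 400 ≤ R ∧ 7 * r + 24 ≤ R / 25
  · obtain ⟨m', hm'⟩ := hM C_L κ ((C_L + 1) * (κ⁻¹ + 1)) t A hL hκ hA hI hPS z b c m R Y₀ Y₂ r hcase.1 hY₀ hY₂ ha hb
      hb2 hz hK1 hKC hr hcase.2
    refine ⟨m', hm'.trans ?_⟩
    nlinarith
  · refine ⟨m, ?_⟩
    have hmono : Blowdown.oscAt (Sites₀ t A) z c r m ≤ Blowdown.oscAt (Sites₀ t A) z c R m :=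
      Blowdown.oscAt_mono (fun c' r' => finite_sites_dist_le hA hI c' r') c (by linarith) m
    -- in the remaining cases `r/R ≥ 1/775`
    have hq : 1 ≤ 775 * (r / R) := by
      rw [not_and_or] at hcase
      rcases hcase with h1 | h2
      · push Not at h1
        rw [div_eq_mul_inv]
        have : 1 ≤ 400 * (r * R⁻¹) := by
          rw [show 400 * (r * R⁻¹) = (400 * r) / R by ring, le_div_iff₀ hR0]; linarith
        nlinarith
      · push Not at h2
        rw [div_eq_mul_inv, show 775 * (r * R⁻¹) = (775 * r) / R by ring, le_div_iff₀ hR0]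
        linarith
    have hq4 : 1 ≤ 775 ^ 4 * (r / R) ^ 4 := by
      have := one_le_pow₀ (n := 4) hq
      rw [mul_pow] at this
      exact this
    calc Blowdown.oscAt (Sites₀ t A) z c r m ≤ Blowdown.oscAt (Sites₀ t A) z c R m := hmono
      _ ≤ 775 ^ 4 * (r / R) ^ 4 * Blowdown.oscAt (Sites₀ t A) z c R m := by nlinarith
      _ ≤ 775 ^ 4 * ((r / R) ^ 4 * Blowdown.oscAt (Sites₀ t A) z c R m +
          r ^ 5 * (Y₀ ^ 2 * (R⁻¹) ^ 6 + Y₂ ^ 2 * (R⁻¹) ^ 8)) := by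
          have : 0 ≤ r ^ 5 * (Y₀ ^ 2 * (R⁻¹) ^ 6 + Y₂ ^ 2 * (R⁻¹) ^ 8) := by positivity
          nlinarith
      _ ≤ (C_M * ((C_L + 1) * (κ⁻¹ + 1)) ^ 4 + 775 ^ 4) * ((r / R) ^ 4 * Blowdown.oscAt (Sites₀ t A) z c R m +
          r ^ 5 * (Y₀ ^ 2 * (R⁻¹) ^ 6 + Y₂ ^ 2 * (R⁻¹) ^ 8)) := by nlinarith

end Summit.AtomisticToContinuum.Crystallization.Theorems.ExcessDecayLiouville

end
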